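import Literature.Computability.QuantumComplexity.CWrapFamily
import Literature.Computability.Complexity.CircuitClassesProofs
import HarnessLib

/-!
# Majority-of-three amplification of a uniform quantum circuit family, I: layout, programs, circuits

Topic `Literature/Computability/QuantumComplexity`; first file of the discharge of the named fact
`Literature.Computability.Cryptography.BQP_eq_BQPWith` (`Cryptography/ClassBQP.lean`: for every
constant `0 < ε < 1/2`, `BQPWith cliffordT ε = BQP` — error reduction for `BQP`, Bernstein–Vazirani
1997, §8.2, Thm. 8.5, p. 1452, whose proof is Bennett–Bernstein–Brassard–Vazirani 1997, Thm. 4.13: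
"We will build a machine that runs `k` independent copies of `M` and then takes the vote of the `k`
answers … this is just like taking the majority of `k` independent coin flips"). We formalise the
round `k = 3` as a transformation of circuit families over the tree's uniform Clifford+T model
(`QuantumCircuit.lean`), to be iterated a constant number of times (`maj3Fn`, the error map
`e ↦ e²(3 - 2e)` of `ArthurMerlinParallelPlay.lean`):

given a family `F` (parameters `Params`: `F` and a polynomial bound `pF` of its ancilla count),
the circuit on inputs of length `n`, on `n + anc n` wires, is

  `stage1 n ++ (⨁_{ℓ < 3} (conjGates n ℓ ++ copyGates n ++ conjGates n ℓ)) ++ stage2 n`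

where (layout: the *front window* `[0, Pw n)` containing the input wires, three *blocks*
`[Pw + ℓ·Pw, Pw + (ℓ+1)·Pw)`, `ℓ < 3`, of the same width, and the *majority wire* `mW n = 4·Pw n`)

* `stage1` is the Clifford+T compilation (`revCompile`) of the fan-out `prog1` copying the input
  into the input wires of the three blocks ("write out `k` copies of the input", BBBV step 2);
* `conjGates n ℓ` is the compiled swap of the front window with block `ℓ` and `copyGates n` is the
  given circuit `F.circ n` placed *verbatim* on the front wires (so that its description is printed
  unchanged, as in `CWrapFamily.lean`); swap–copy–swap runs the copy on block `ℓ` ("loop `k` times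
  on a machine that runs `M`", BBBV step 3; `WireConjugation.toMatrix_conj_mapWires`);
* `stage2` is the compilation of `prog2 = progMaj ++ progOut`: three Toffoli gates writing the
  majority of the three answer wires (wire `0` of each block) into the majority wire, and the swap of
  that wire with wire `0` ("calculate the majority of the `k` answers and write it back in the start
  cell", BBBV step 4).

This file fixes the layout (`Pw`, `blockW`, `mW`, `width`, `anc`), the programs with their
well-formedness and wire bounds (`clamp` onto `Fin (n + anc n)`), the semantics of `prog1` on the
input (`w1`), the family `Maj3Amp.family` (oracle-free if `F` is), and the matrices of the stages on
basis states (`toMatrix_stage1_mulVec_pad`, `toMatrix_conjBlock`, `perm2`). The acceptance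
probability is computed in `Maj3AmpKernel.lean`, uniformity in `Maj3AmpUniform.lean`.

## References

* E. Bernstein, U. Vazirani, *Quantum complexity theory*, SIAM J. Comput. 26 (1997) 1411–1473,
  §8.1 Def. 8.1 (acceptance with probability `p`, `BQP`), §8.2 Thm. 8.5 (p. 1452).
* C. H. Bennett, E. Bernstein, G. Brassard, U. Vazirani, *Strengths and weaknesses of quantum
  computing*, SIAM J. Comput. 26 (1997) 1510–1523, Thm. 4.13 (boosting by majority vote over
  independent copies) [BennettBernsteinBrassardVazirani1997].
* M. A. Nielsen, I. L. Chuang, *Quantum Computation and Quantum Information*, CUP 2010, §1.3.4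
  (swap from three `CNOT`s), §3.2.5 (fan-out, Toffoli), §4.3, §4.5.5.
-/

noncomputable section

namespace Literature.Computability.QuantumComplexity

namespace Maj3Amp

open _root_.Computability Complexity Function RevSim RevClean Cryptography RevMux Matrix

/-! ### Parameters and layout -/

/-- Parameters (a hypothesis structure): the family being amplified and a polynomial bound on its
ancilla count (`QCircuitFamily.IsUniform.isPolySize_holds`). [folklore] -/
structure Params where
  /-- the family being amplified -/
  F : QCircuitFamily cliffordT
  /-- a polynomial … -/
  pF : Polynomial ℕ
  /-- … bounding the ancilla count -/
  hpF : ∀ m, F.ancillas m ≤ pF.eval m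

variable (P : Params)

/-- The common width of the front window and of the three blocks: room for the `n + F.ancillas n`
wires of the copy, and one idle wire (so that the width is positive). [folklore] -/
def Pw (n : ℕ) : ℕ := n + P.pF.eval n + 1

/-- Wire `i` of block `ℓ` (the blocks start right after the front window `[0, Pw)`).
[cite: BennettBernsteinBrassardVazirani1997, Thm. 4.13 (proof; step 2: k copies of the input spaced out)] -/
def blockW (n ℓ i : ℕ) : ℕ := Pw P n + ℓ * Pw P n + i

/-- The majority wire, right after the three blocks. [cite: BennettBernsteinBrassardVazirani1997, Thm. 4.13 (proof; step 4)] -/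
def mW (n : ℕ) : ℕ := Pw P n + 3 * Pw P n

/-- The total number of wires. [folklore] -/
def width (n : ℕ) : ℕ := mW P n + 1

/-- The number of ancilla wires. [folklore] -/
def anc (n : ℕ) : ℕ := width P n - n

/-! ### Size bookkeeping -/

/-- `1 ≤ Pw n`. [folklore] -/
theorem one_le_Pw (n : ℕ) : 1 ≤ Pw P n := by unfold Pw; omega

/-- The input wires lie in the front window: `n < Pw n`. [folklore] -/
theorem lt_Pw (n : ℕ) : n < Pw P n := by unfold Pw; omega

/-- **The copy fits into the front window**: `n + F.ancillas n ≤ Pw n`. [folklore] -/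
theorem le_Pw (n : ℕ) : n + P.F.ancillas n ≤ Pw P n := by
  have := P.hpF n
  unfold Pw; omega

/-- The blocks start beyond the front window. [folklore] -/
theorem Pw_le_blockW (n ℓ i : ℕ) : Pw P n ≤ blockW P n ℓ i := by unfold blockW; omega

/-- `blockW n ℓ i = blockW n ℓ 0 + i`. [folklore] -/
theorem blockW_eq_add (n ℓ i : ℕ) : blockW P n ℓ i = blockW P n ℓ 0 + i := by unfold blockW; omega

/-- Block wires of one block are injective in the position. [folklore] -/
theorem blockW_injective (n ℓ : ℕ) : Injective (blockW P n ℓ) := fun i i' h => by unfold blockW at h; omega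

/-- Distinct blocks are disjoint (positions below the width). [folklore] -/
theorem blockW_inj {n ℓ i ℓ' i' : ℕ} (hi : i < Pw P n) (hi' : i' < Pw P n) (h : blockW P n ℓ i = blockW P n ℓ' i') :
    ℓ = ℓ' ∧ i = i' := by
  unfold blockW at h
  have h2 : ℓ * Pw P n + i = ℓ' * Pw P n + i' := by omega
  have hl : ℓ = ℓ' := by
    rcases lt_trichotomy ℓ ℓ' with hlt | heq | hgt
    · have : (ℓ + 1) * Pw P n ≤ ℓ' * Pw P n := Nat.mul_le_mul_right _ hlt
      rw [Nat.succ_mul] at this; omega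
    · exact heq
    · have : (ℓ' + 1) * Pw P n ≤ ℓ * Pw P n := Nat.mul_le_mul_right _ hgt
      rw [Nat.succ_mul] at this; omega
  subst hl
  exact ⟨rfl, by omega⟩

/-- Block wires of the three blocks lie below the majority wire. [folklore] -/
theorem blockW_lt_mW {n ℓ i : ℕ} (hℓ : ℓ < 3) (hi : i < Pw P n) : blockW P n ℓ i < mW P n := by
  unfold blockW mW
  have h : (ℓ + 1) * Pw P n ≤ 3 * Pw P n := Nat.mul_le_mul_right _ hℓ
  rw [Nat.succ_mul] at h
  omega

/-- The majority wire is the last wire. [folklore] -/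
theorem mW_lt_width (n : ℕ) : mW P n < width P n := by unfold width; omega

/-- The majority wire is not wire `0`. [folklore] -/
theorem mW_ne_zero (n : ℕ) : mW P n ≠ 0 := by have := one_le_Pw P n; unfold mW; omega

/-- The front window lies below the majority wire. [folklore] -/
theorem Pw_le_mW (n : ℕ) : Pw P n ≤ mW P n := by unfold mW; omega

/-- **The width is `n + anc n`.** [folklore] -/
theorem n_add_anc (n : ℕ) : n + anc P n = width P n := by
  have := lt_Pw P n
  unfold anc width mW; omega

/-- The register is nonempty. [folklore] -/
theorem width_pos (n : ℕ) : 0 < n + anc P n := by rw [n_add_anc]; unfold width; omega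

/-- Block wires fit. [folklore] -/
theorem blockW_fits {n ℓ i : ℕ} (hℓ : ℓ < 3) (hi : i < Pw P n) : blockW P n ℓ i < n + anc P n := by
  rw [n_add_anc]; exact (blockW_lt_mW P hℓ hi).trans (mW_lt_width P n)

/-- The majority wire fits. [folklore] -/
theorem mW_fits (n : ℕ) : mW P n < n + anc P n := by rw [n_add_anc]; exact mW_lt_width P n

/-- The front window fits. [folklore] -/
theorem Pw_fits (n : ℕ) : Pw P n ≤ n + anc P n := (Pw_le_mW P n).trans (mW_fits P n).le

/-- The copy fits into the register. [folklore] -/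
theorem copy_fits (n : ℕ) : n + P.F.ancillas n ≤ n + anc P n := (le_Pw P n).trans (Pw_fits P n)

/-! ### The programs -/

/-- The fan-out pairs: input wire `j` into wire `j` of block `ℓ`, for `ℓ < 3`, `j < n`.
[cite: BennettBernsteinBrassardVazirani1997, Thm. 4.13 (proof; step 2: write out k copies of the input)] -/
def fanPairs (n : ℕ) : List (ℕ × ℕ) := (List.range 3).flatMap fun ℓ => (List.range n).map fun j => (j, blockW P n ℓ j)

/-- **Stage 1 as a program**: the fan-out of the input into the three blocks (`CNOT`s).
[cite: NielsenChuang2010, §3.2.5 (FANOUT by CNOT)] -/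
def prog1 (n : ℕ) : List (ClOp ℕ) := copyOps (fanPairs P n)

/-- The pairs of the conjugating swap of block `ℓ`: front wire `i` with wire `i` of block `ℓ`.
[folklore] -/
def conjPairs (n ℓ : ℕ) : List (ℕ × ℕ) := (List.range (Pw P n)).map fun i => (i, blockW P n ℓ i)

/-- The conjugating swap of block `ℓ`, as a program. [cite: NielsenChuang2010, §1.3.4 (swap from three CNOTs)] -/
def progConj (n ℓ : ℕ) : List (ClOp ℕ) := swapOps (conjPairs P n ℓ)

/-- **The majority gadget**: three Toffoli gates `mW ← mW ⊕ ab ⊕ bc ⊕ ac` on the answer wires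
`a, b, c` (wire `0` of each block); on `mW = 0` this writes the majority of `a, b, c`.
[cite: BennettBernsteinBrassardVazirani1997, Thm. 4.13 (proof; step 4: calculate the majority of the k answers)] -/
def progMaj (n : ℕ) : List (ClOp ℕ) :=
  [ClOp.toffoli (blockW P n 0 0) (blockW P n 1 0) (mW P n), ClOp.toffoli (blockW P n 1 0) (blockW P n 2 0) (mW P n),
    ClOp.toffoli (blockW P n 0 0) (blockW P n 2 0) (mW P n)]

/-- **The output swap**: exchange the majority wire and wire `0` ("write it back in the start
cell"). [cite: BennettBernsteinBrassardVazirani1997, Thm. 4.13 (proof; step 4)] -/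
def progOut (n : ℕ) : List (ClOp ℕ) := [ClOp.cnot (mW P n) 0, ClOp.cnot 0 (mW P n), ClOp.cnot (mW P n) 0]

/-- **Stage 2 as a program**: majority, then output swap. [folklore] -/
def prog2 (n : ℕ) : List (ClOp ℕ) := progMaj P n ++ progOut P n

/-- Membership in the fan-out pairs. [folklore] -/
theorem mem_fanPairs {n : ℕ} {p : ℕ × ℕ} : p ∈ fanPairs P n ↔ ∃ ℓ < 3, ∃ j < n, p = (j, blockW P n ℓ j) := by
  simp only [fanPairs, List.mem_flatMap, List.mem_range, List.mem_map]
  constructor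
  · rintro ⟨ℓ, hℓ, j, hj, rfl⟩; exact ⟨ℓ, hℓ, j, hj, rfl⟩
  · rintro ⟨ℓ, hℓ, j, hj, rfl⟩; exact ⟨ℓ, hℓ, j, hj, rfl⟩

/-! ### Well-formedness -/

/-- `prog1` is well formed. [folklore] -/
theorem prog1_wf (n : ℕ) : ∀ op ∈ prog1 P n, op.WF := by
  refine copyOps_wf fun p hp => ?_
  obtain ⟨ℓ, -, j, hj, rfl⟩ := (mem_fanPairs P).1 hp
  exact Nat.ne_of_lt (lt_of_lt_of_le (hj.trans (lt_Pw P n)) (Pw_le_blockW P n ℓ j))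

/-- `progConj` is well formed. [folklore] -/
theorem progConj_wf (n ℓ : ℕ) : ∀ op ∈ progConj P n ℓ, op.WF := by
  refine swapOps_wf fun p hp => ?_
  simp only [conjPairs, List.mem_map, List.mem_range] at hp
  obtain ⟨i, hi, rfl⟩ := hp
  exact Nat.ne_of_lt (lt_of_lt_of_le hi (Pw_le_blockW P n ℓ i))

/-- `prog2` is well formed. [folklore] -/
theorem prog2_wf (n : ℕ) : ∀ op ∈ prog2 P n, op.WF := by
  have h1 := one_le_Pw P n
  intro op hop
  simp only [prog2, progMaj, progOut, List.mem_append, List.mem_cons, List.not_mem_nil, or_false] at hop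
  rcases hop with (rfl | rfl | rfl) | (rfl | rfl | rfl)
  · exact ⟨by unfold blockW; omega, by unfold blockW mW; omega, by unfold blockW mW; omega⟩
  · exact ⟨by unfold blockW; omega, by unfold blockW mW; omega, by unfold blockW mW; omega⟩
  · exact ⟨by unfold blockW; omega, by unfold blockW mW; omega, by unfold blockW mW; omega⟩
  · exact mW_ne_zero P n
  · exact (mW_ne_zero P n).symm
  · exact mW_ne_zero P n

/-! ### Wire bounds -/

/-- `prog1` fits. [folklore] -/
theorem prog1_lt (n : ℕ) : ∀ op ∈ prog1 P n, ∀ i ∈ wiresOf op, i < n + anc P n := by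
  intro op hop i hi
  obtain ⟨p, hp, rfl⟩ := mem_copyOps.1 hop
  obtain ⟨ℓ, hℓ, j, hj, rfl⟩ := (mem_fanPairs P).1 hp
  simp only [mem_wiresOf, ClOp.target, ClOp.controls, List.mem_singleton] at hi
  rcases hi with rfl | rfl
  · exact blockW_fits P hℓ (hj.trans (lt_Pw P n))
  · exact lt_of_lt_of_le (hj.trans (lt_Pw P n)) (Pw_fits P n)

/-- `progConj n ℓ`, `ℓ < 3`, fits. [folklore] -/
theorem progConj_lt {n ℓ : ℕ} (hℓ : ℓ < 3) : ∀ op ∈ progConj P n ℓ, ∀ i ∈ wiresOf op, i < n + anc P n := by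
  intro op hop i hi
  obtain ⟨p, hp, h⟩ := CWrap.wiresOf_swapOps hop i hi
  simp only [conjPairs, List.mem_map, List.mem_range] at hp
  obtain ⟨k, hk, rfl⟩ := hp
  rcases h with rfl | rfl
  · exact lt_of_lt_of_le hk (Pw_fits P n)
  · exact blockW_fits P hℓ hk

/-- `prog2` fits. [folklore] -/
theorem prog2_lt (n : ℕ) : ∀ op ∈ prog2 P n, ∀ i ∈ wiresOf op, i < n + anc P n := by
  have h0 : blockW P n 0 0 < n + anc P n := blockW_fits P (by norm_num) (one_le_Pw P n)
  have h1 : blockW P n 1 0 < n + anc P n := blockW_fits P (by norm_num) (one_le_Pw P n)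
  have h2 : blockW P n 2 0 < n + anc P n := blockW_fits P (by norm_num) (one_le_Pw P n)
  have hm := mW_fits P n
  have hz := width_pos P n
  intro op hop i hi
  simp only [prog2, progMaj, progOut, List.mem_append, List.mem_cons, List.not_mem_nil, or_false] at hop
  rcases hop with (rfl | rfl | rfl) | (rfl | rfl | rfl) <;>
    simp only [mem_wiresOf, ClOp.target, ClOp.controls, List.mem_cons, List.not_mem_nil, or_false] at hi
  · rcases hi with rfl | rfl | rfl <;> assumption
  · rcases hi with rfl | rfl | rfl <;> assumption
  · rcases hi with rfl | rfl | rfl <;> assumption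
  · rcases hi with rfl | rfl <;> assumption
  · rcases hi with rfl | rfl <;> assumption
  · rcases hi with rfl | rfl <;> assumption

/-! ### Compilation on `n + anc n` wires -/

/-- A program over `ℕ` with wires below `n + anc n`, re-indexed to `Fin (n + anc n)` and turned
into reversible operations (`RevGadgets.toRevList`). [cite: AroraBarak2009, §10.3.7 Lemma 10.10] -/
def clamp (n : ℕ) (ops : List (ClOp ℕ)) (hlt : ∀ op ∈ ops, ∀ i ∈ wiresOf op, i < n + anc P n)
    (hwf : ∀ op ∈ ops, op.WF) : List (RevOp (n + anc P n)) :=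
  toRevList (ops.map (ClOp.map (finOf (n + anc P n) (width_pos P n)))) fun op hop => by
    simp only [List.mem_map] at hop
    obtain ⟨op, hop, rfl⟩ := hop
    exact wf_map_finOf _ (hlt op hop) (hwf op hop)

/-- **Semantics of a clamped program**: on `Fin (n + anc n)` it acts as the `ℕ`-program on the
lifted assignment. [folklore] -/
theorem revEval_clamp (n : ℕ) (ops : List (ClOp ℕ)) (hlt : ∀ op ∈ ops, ∀ i ∈ wiresOf op, i < n + anc P n)
    (hwf : ∀ op ∈ ops, op.WF) (w : QReg (n + anc P n)) (p : Fin (n + anc P n)) :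
    revEval (clamp P n ops hlt hwf) w p = clEval ops (liftW w) p := by
  unfold clamp
  rw [revEval_toRevList, clEval_map_finOf_apply _ ops hlt]

/-! ### Semantics of stage 1 -/

section Stage1

variable (x : List Bool)

/-- **The assignment after stage 1** on the input `x 0 0 …`. [folklore] -/
def w1 : ℕ → Bool := clEval (prog1 P x.length) (strW x)

/-- The input string beyond its length reads `0`. [folklore] -/
theorem strW_of_le {i : ℕ} (hi : x.length ≤ i) : strW x i = false := by
  unfold strW
  rw [List.getD_eq_getElem?_getD, List.getElem?_eq_none hi]
  rfl

/-- **After stage 1, wire `j < n` of each block holds `x[j]`.** [cite: NielsenChuang2010, §3.2.5 (FANOUT by CNOT)] -/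
theorem w1_blockW_of_lt {ℓ j : ℕ} (hℓ : ℓ < 3) (hj : j < x.length) : w1 P x (blockW P x.length ℓ j) = x.getD j false := by
  unfold w1 prog1
  have hnd : ((fanPairs P x.length).map Prod.snd).Nodup := by
    rw [List.nodup_map_iff_inj_on]
    · intro p hp q hq h
      obtain ⟨ℓ, hℓ, j, hj, rfl⟩ := (mem_fanPairs P).1 hp
      obtain ⟨ℓ', hℓ', j', hj', rfl⟩ := (mem_fanPairs P).1 hq
      obtain ⟨h1, h2⟩ := blockW_inj P (hj.trans (lt_Pw P _)) (hj'.trans (lt_Pw P _)) h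
      subst h1; subst h2; rfl
    · unfold fanPairs
      rw [List.nodup_flatMap]
      refine ⟨fun ℓ _ => (List.nodup_range).map_on fun a _ b _ h => (Prod.mk.injEq _ _ _ _ ▸ h).1, ?_⟩
      refine List.nodup_range.pairwise_of_forall_ne fun ℓ _ ℓ' _ hne => ?_
      simp only [Function.onFun, List.disjoint_left, List.mem_map, List.mem_range]
      rintro p ⟨j, hj, rfl⟩ ⟨j', hj', h⟩
      have := blockW_inj P (hj'.trans (lt_Pw P _)) (hj.trans (lt_Pw P _)) (Prod.mk.injEq _ _ _ _ ▸ h).2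
      exact hne this.1.symm
  have hdis : ∀ p ∈ fanPairs P x.length, ∀ q ∈ fanPairs P x.length, q.2 ≠ p.1 := by
    intro p hp q hq
    obtain ⟨ℓ, -, j, hj, rfl⟩ := (mem_fanPairs P).1 hp
    obtain ⟨ℓ', -, j', -, rfl⟩ := (mem_fanPairs P).1 hq
    exact (Nat.ne_of_lt (lt_of_lt_of_le (hj.trans (lt_Pw P _)) (Pw_le_blockW P _ ℓ' j'))).symm
  have hp : (j, blockW P x.length ℓ j) ∈ fanPairs P x.length := (mem_fanPairs P).2 ⟨ℓ, hℓ, j, hj, rfl⟩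
  have h := clEval_copyOps_target (fanPairs P x.length) hnd hdis (strW x) hp
  simp only at h
  rw [h, strW_of_le x (le_of_lt (lt_of_lt_of_le (lt_Pw P _) (Pw_le_blockW P _ ℓ j)))]
  simp [strW]

/-- After stage 1, a wire that is no fan-out target is unchanged. [folklore] -/
theorem w1_of_forall_ne {i : ℕ} (hi : ∀ ℓ < 3, ∀ j < x.length, blockW P x.length ℓ j ≠ i) : w1 P x i = strW x i := by
  unfold w1 prog1
  refine clEval_copyOps_of_ne _ _ fun p hp => ?_
  obtain ⟨ℓ, hℓ, j, hj, rfl⟩ := (mem_fanPairs P).1 hp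
  exact hi ℓ hℓ j hj

/-- **After stage 1, the input wires still hold `x`.** [folklore] -/
theorem w1_of_lt {i : ℕ} (hi : i < x.length) : w1 P x i = x.getD i false := by
  rw [w1_of_forall_ne P x (fun ℓ _ j _ => (Nat.ne_of_lt (lt_of_lt_of_le (hi.trans (lt_Pw P _)) (Pw_le_blockW P _ ℓ j))).symm)]
  rfl

/-- After stage 1, the rest of the front window is `0`. [folklore] -/
theorem w1_front_of_le {i : ℕ} (hi : x.length ≤ i) (hi' : i < Pw P x.length) : w1 P x i = false := by
  rw [w1_of_forall_ne P x (fun ℓ _ j _ => (Nat.ne_of_lt (lt_of_lt_of_le hi' (Pw_le_blockW P _ ℓ j))).symm)]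
  exact strW_of_le x hi

/-- **After stage 1, wire `i ≥ n` of each block is `0`.** [folklore] -/
theorem w1_blockW_of_le {ℓ i : ℕ} (hi : x.length ≤ i) (hi' : i < Pw P x.length) : w1 P x (blockW P x.length ℓ i) = false := by
  rw [w1_of_forall_ne P x (fun ℓ' _ j hj h => ?_)]
  · exact strW_of_le x ((lt_Pw P _).le.trans (Pw_le_blockW P _ ℓ i))
  · have := (blockW_inj P (hj.trans (lt_Pw P _)) hi' h).2
    omega

/-- After stage 1, everything from the majority wire on is `0`. [folklore] -/
theorem w1_of_mW_le {i : ℕ} (hi : mW P x.length ≤ i) : w1 P x i = false := by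
  rw [w1_of_forall_ne P x (fun ℓ hℓ j hj h => ?_)]
  · exact strW_of_le x ((lt_Pw P _).le.trans ((Pw_le_mW P _).trans hi))
  · have := blockW_lt_mW P hℓ (hj.trans (lt_Pw P _))
    omega

end Stage1

/-! ### The circuits -/

/-- **The conjugating swap of block `ℓ`**, compiled (empty for `ℓ ≥ 3`). [cite: NielsenChuang2010, §1.3.4 (swap from three CNOTs)] -/
def conjGates (n ℓ : ℕ) : List (QGate cliffordT (n + anc P n)) :=
  if h : ℓ < 3 then revCompile (clamp P n (progConj P n ℓ) (progConj_lt P h) (progConj_wf P n ℓ)) else []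

/-- **The copy**: `F.circ n` on the front wires, verbatim. [cite: BennettBernsteinBrassardVazirani1997, Thm. 4.13 (proof; step 3: run the given machine)] -/
def copyGates (n : ℕ) : List (QGate cliffordT (n + anc P n)) :=
  (mapWires (Fin.castLEEmb (copy_fits P n)) (P.F.circ n)).gates

/-- The quantum stage: for every `ℓ < 3`, swap, copy, swap back. [cite: BennettBernsteinBrassardVazirani1997, Thm. 4.13 (proof; step 3: loop k times on a machine that runs M)] -/
def stageQ (n : ℕ) : List (QGate cliffordT (n + anc P n)) :=
  (List.range 3).flatMap fun ℓ => conjGates P n ℓ ++ (copyGates P n ++ conjGates P n ℓ)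

/-- Stage 1, compiled. [folklore] -/
def stage1 (n : ℕ) : List (QGate cliffordT (n + anc P n)) :=
  revCompile (clamp P n (prog1 P n) (prog1_lt P n) (prog1_wf P n))

/-- Stage 2, compiled. [folklore] -/
def stage2 (n : ℕ) : List (QGate cliffordT (n + anc P n)) :=
  revCompile (clamp P n (prog2 P n) (prog2_lt P n) (prog2_wf P n))

/-- **The circuit of the amplified family on inputs of length `n`.** [cite: BennettBernsteinBrassardVazirani1997, Thm. 4.13 (proof)] -/
def circ (n : ℕ) : QCircuit cliffordT (n + anc P n) := ⟨stage1 P n ++ (stageQ P n ++ stage2 P n)⟩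

/-- **The amplified family** (three independent copies and a majority vote).
[cite: BennettBernsteinBrassardVazirani1997, Thm. 4.13] -/
def family : QCircuitFamily cliffordT := ⟨anc P, circ P⟩

/-- The circuit of the family (definitional). [folklore] -/
@[simp] theorem family_circ (n : ℕ) : (family P).circ n = circ P n := rfl

/-- The ancillas of the family (definitional). [folklore] -/
@[simp] theorem family_ancillas (n : ℕ) : (family P).ancillas n = anc P n := rfl

/-- **The amplified family is oracle-free** (if the given one is). [folklore] -/
theorem family_isOracleFree (hF : P.F.IsOracleFree) : (family P).IsOracleFree := by
  intro n g hg
  have hg' : g ∈ stage1 P n ++ (stageQ P n ++ stage2 P n) := hg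
  rcases List.mem_append.1 hg' with h | h
  · exact revCompile_isOracleFree (clamp P n (prog1 P n) (prog1_lt P n) (prog1_wf P n)) g h
  rcases List.mem_append.1 h with h | h
  · obtain ⟨ℓ, -, h⟩ := List.mem_flatMap.1 h
    have hconj : g ∈ conjGates P n ℓ → g.IsOracleFree := fun h => by
      unfold conjGates at h
      split_ifs at h with hℓ
      · exact revCompile_isOracleFree (clamp P n (progConj P n ℓ) (progConj_lt P hℓ) (progConj_wf P n ℓ)) g h
      · exact absurd h List.not_mem_nil
    rcases List.mem_append.1 h with h | h
    · exact hconj h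
    rcases List.mem_append.1 h with h | h
    · exact isOracleFree_mapWires _ (hF n) g h
    · exact hconj h
  · exact revCompile_isOracleFree (clamp P n (prog2 P n) (prog2_lt P n) (prog2_wf P n)) g h

/-! ### Stage 1 on the input -/

/-- **Stage 1 on a basis state.** [cite: AroraBarak2009, §10.3.7 Lemma 10.10] -/
theorem toMatrix_stage1_mulVec_basisState (A : Language Bool) (n : ℕ) (w : QReg (n + anc P n)) :
    (⟨stage1 P n⟩ : QCircuit cliffordT (n + anc P n)).toMatrix A *ᵥ basisState w =
      basisState (fun p => clEval (prog1 P n) (liftW w) p) := by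
  rw [stage1, revCompile_mulVec_basisState]
  congr 1
  funext p
  exact revEval_clamp P n _ _ _ w p

/-- The basis label after stage 1 on the input `x`: the assignment `w1 x`. [folklore] -/
def W1 (x : List Bool) : QReg (x.length + anc P x.length) := fun p => w1 P x p

/-- **Stage 1 on the input `|x 0…0⟩` yields `|w1 x⟩`.** [cite: NielsenChuang2010, §3.2.5 (FANOUT by CNOT)] -/
theorem toMatrix_stage1_mulVec_pad (A : Language Bool) (x : List Bool) :
    (⟨stage1 P x.length⟩ : QCircuit cliffordT (x.length + anc P x.length)).toMatrix A *ᵥ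
        basisState (padInput x.get (anc P x.length)) = basisState (W1 P x) := by
  rw [toMatrix_stage1_mulVec_basisState, CWrap.liftW_padInput_get]
  rfl

/-! ### The conjugating swap -/

section Conj

variable {P} {n ℓ : ℕ} (hℓ : ℓ < 3)

/-- **The wire involution of the conjugating swap**: front wire `i < Pw` ↔ wire `i` of block
`ℓ`, all other wires fixed. [cite: NielsenChuang2010, §1.3.4 (swap from three CNOTs)] -/
def conjInvol (hℓ : ℓ < 3) (p : Fin (n + anc P n)) : Fin (n + anc P n) :=
  if h1 : (p : ℕ) < Pw P n then ⟨blockW P n ℓ p, blockW_fits P hℓ h1⟩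
  else if h2 : blockW P n ℓ 0 ≤ p ∧ (p : ℕ) < blockW P n ℓ 0 + Pw P n then
    ⟨p - blockW P n ℓ 0, by have := p.isLt; omega⟩
  else p

/-- `conjInvol` on a front wire. [folklore] -/
theorem conjInvol_of_lt {p : Fin (n + anc P n)} (hp : (p : ℕ) < Pw P n) :
    (conjInvol hℓ p : ℕ) = blockW P n ℓ p := by
  unfold conjInvol; rw [dif_pos hp]

/-- `conjInvol` on a block wire. [folklore] -/
theorem conjInvol_blockW {i : ℕ} (hi : i < Pw P n) :
    (conjInvol hℓ ⟨blockW P n ℓ i, blockW_fits P hℓ hi⟩ : ℕ) = i := by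
  have h1 : ¬ blockW P n ℓ i < Pw P n := Nat.not_lt.2 (Pw_le_blockW P n ℓ i)
  have h2 : blockW P n ℓ 0 ≤ blockW P n ℓ i ∧ blockW P n ℓ i < blockW P n ℓ 0 + Pw P n := by
    rw [blockW_eq_add P n ℓ i]; omega
  unfold conjInvol
  rw [dif_neg h1, dif_pos h2]
  simp [blockW_eq_add P n ℓ i]

/-- `conjInvol` elsewhere. [folklore] -/
theorem conjInvol_of_not {p : Fin (n + anc P n)} (hp : ¬ (p : ℕ) < Pw P n)
    (hp' : ¬ (blockW P n ℓ 0 ≤ p ∧ (p : ℕ) < blockW P n ℓ 0 + Pw P n)) :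
    conjInvol hℓ p = p := by
  unfold conjInvol; rw [dif_neg hp, dif_neg hp']

/-- **`conjInvol` is an involution.** [folklore] -/
theorem conjInvol_conjInvol (p : Fin (n + anc P n)) : conjInvol hℓ (conjInvol hℓ p) = p := by
  have hPw := Pw_le_blockW P n ℓ 0
  by_cases h1 : (p : ℕ) < Pw P n
  · have e : conjInvol hℓ p = ⟨blockW P n ℓ p, blockW_fits P hℓ h1⟩ := by unfold conjInvol; rw [dif_pos h1]
    rw [e]
    exact Fin.ext (conjInvol_blockW hℓ h1)
  · by_cases h2 : blockW P n ℓ 0 ≤ p ∧ (p : ℕ) < blockW P n ℓ 0 + Pw P n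
    · have hi : (p : ℕ) - blockW P n ℓ 0 < Pw P n := by omega
      have e : conjInvol hℓ p = ⟨p - blockW P n ℓ 0, by have := p.isLt; omega⟩ := by
        unfold conjInvol; rw [dif_neg h1, dif_pos h2]
      rw [e]
      apply Fin.ext
      rw [conjInvol_of_lt hℓ (by exact hi)]
      simp only
      rw [blockW_eq_add P n ℓ]; omega
    · rw [conjInvol_of_not hℓ h1 h2, conjInvol_of_not hℓ h1 h2]

/-- **The compiled conjugating swap permutes basis states along `conjInvol`.** [cite: NielsenChuang2010, §1.3.4 (swap from three CNOTs)] -/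
theorem toMatrix_conjGates_mulVec_basisState (A : Language Bool) (w : QReg (n + anc P n)) :
    (⟨conjGates P n ℓ⟩ : QCircuit cliffordT (n + anc P n)).toMatrix A *ᵥ basisState w = basisState (w ∘ conjInvol hℓ) := by
  unfold conjGates
  rw [dif_pos hℓ, revCompile_mulVec_basisState]
  congr 1
  funext p
  rw [revEval_clamp]
  unfold progConj
  -- the hypotheses of `clEval_swapOps`
  have h1 : ((conjPairs P n ℓ).map Prod.fst).Nodup := by
    rw [conjPairs, List.map_map]; simpa [Function.comp_def] using List.nodup_range
  have h2 : ((conjPairs P n ℓ).map Prod.snd).Nodup := by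
    rw [conjPairs, List.map_map]
    exact List.nodup_range.map_on fun a _ b _ h => blockW_injective P n ℓ h
  have h12 : ∀ q ∈ conjPairs P n ℓ, ∀ q' ∈ conjPairs P n ℓ, q.1 ≠ q'.2 := by
    intro q hq q' hq'
    simp only [conjPairs, List.mem_map, List.mem_range] at hq hq'
    obtain ⟨i, hi, rfl⟩ := hq; obtain ⟨i', -, rfl⟩ := hq'
    exact Nat.ne_of_lt (lt_of_lt_of_le hi (Pw_le_blockW P n ℓ i'))
  obtain ⟨hsnd, hfst, hother⟩ := clEval_swapOps (conjPairs P n ℓ) h1 h2 h12 (liftW w)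
  simp only [Function.comp_apply]
  by_cases hp : (p : ℕ) < Pw P n
  · -- a front wire receives the block wire
    have hmem : ((p : ℕ), blockW P n ℓ p) ∈ conjPairs P n ℓ := List.mem_map.2 ⟨p, List.mem_range.2 hp, rfl⟩
    rw [hfst _ hmem]
    change liftW w (blockW P n ℓ p) = w (conjInvol hℓ p)
    rw [← liftW_val w (conjInvol hℓ p), conjInvol_of_lt hℓ hp]
  · by_cases hp2 : blockW P n ℓ 0 ≤ p ∧ (p : ℕ) < blockW P n ℓ 0 + Pw P n
    · -- a block wire receives the front wire
      have hi : (p : ℕ) - blockW P n ℓ 0 < Pw P n := by omega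
      have hpe : (p : ℕ) = blockW P n ℓ (p - blockW P n ℓ 0) := by rw [blockW_eq_add P n ℓ]; omega
      have hmem : ((p : ℕ) - blockW P n ℓ 0, (p : ℕ)) ∈ conjPairs P n ℓ :=
        List.mem_map.2 ⟨_, List.mem_range.2 hi, by rw [← hpe]⟩
      rw [hsnd _ hmem]
      change liftW w ((p : ℕ) - blockW P n ℓ 0) = w (conjInvol hℓ p)
      rw [← liftW_val w (conjInvol hℓ p)]
      congr 1
      unfold conjInvol; rw [dif_neg hp, dif_pos hp2]
    · rw [hother _ (fun q hq => ?_), conjInvol_of_not hℓ hp hp2, liftW_val]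
      simp only [conjPairs, List.mem_map, List.mem_range] at hq
      obtain ⟨i, hi, rfl⟩ := hq
      refine ⟨fun h => hp (h ▸ hi), fun h => hp2 ?_⟩
      rw [h, blockW_eq_add P n ℓ i]; omega

/-- The block embedding: position `i` of the copy ↦ wire `i` of block `ℓ`. [folklore] -/
def blockEmbCopy (hℓ : ℓ < 3) : Fin (n + P.F.ancillas n) ↪ Fin (n + anc P n) :=
  (Fin.castLEEmb (copy_fits P n)).trans (invEmb (conjInvol hℓ) (conjInvol_conjInvol hℓ))

/-- `blockEmbCopy` lands in block `ℓ`. [folklore] -/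
theorem blockEmbCopy_apply (i : Fin (n + P.F.ancillas n)) : (blockEmbCopy hℓ i : ℕ) = blockW P n ℓ i := by
  have hi : (i : ℕ) < Pw P n := lt_of_lt_of_le i.isLt (le_Pw P n)
  simp only [blockEmbCopy, Function.Embedding.trans_apply, invEmb_apply]
  exact conjInvol_of_lt hℓ (by simpa using hi)

/-- **Swap–copy–swap computes the copy on block `ℓ`.** [cite: NielsenChuang2010, §4.3 (a gate on a subset of the wires is U ⊗ 1 up to the order of the factors)] -/
theorem toMatrix_conjBlock (A : Language Bool) :
    (⟨conjGates P n ℓ ++ (copyGates P n ++ conjGates P n ℓ)⟩ : QCircuit cliffordT (n + anc P n)).toMatrix A =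
      (mapWires (blockEmbCopy hℓ) (P.F.circ n)).toMatrix A := by
  rw [copyGates, toMatrix_conj_mapWires A (conjInvol hℓ) (conjInvol_conjInvol hℓ) (conjGates P n ℓ)
    (toMatrix_conjGates_mulVec_basisState hℓ A) (Fin.castLEEmb (copy_fits P n)) (P.F.circ n)]
  rfl

end Conj

/-! ### Stage 2 as a permutation of the basis labels -/

/-- **Stage 2 as an injective self-map of the basis labels.** [cite: NielsenChuang2010, §3.2.5 (reversible classical computation on basis states)] -/
def perm2 (n : ℕ) : QReg (n + anc P n) ↪ QReg (n + anc P n) :=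
  ⟨revEval (clamp P n (prog2 P n) (prog2_lt P n) (prog2_wf P n)), by
    unfold clamp
    intro a b h
    rw [revEval_toRevList, revEval_toRevList] at h
    exact clEval_injective _ (fun op hop => by
      simp only [List.mem_map] at hop
      obtain ⟨op, hop, rfl⟩ := hop
      exact wf_map_finOf _ (prog2_lt P n op hop) (prog2_wf P n op hop)) h⟩

/-- `perm2` evaluated: the `ℕ`-program on the lifted assignment. [folklore] -/
theorem perm2_apply (n : ℕ) (z : QReg (n + anc P n)) (p : Fin (n + anc P n)) :
    perm2 P n z p = clEval (prog2 P n) (liftW z) p :=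
  revEval_clamp P n _ _ _ z p

/-- **Stage 2 permutes basis states along `perm2`.** [cite: AroraBarak2009, §10.3.7 Lemma 10.10] -/
theorem toMatrix_stage2_mulVec_basisState (A : Language Bool) (n : ℕ) (z : QReg (n + anc P n)) :
    (⟨stage2 P n⟩ : QCircuit cliffordT (n + anc P n)).toMatrix A *ᵥ basisState z = basisState (perm2 P n z) := by
  rw [stage2, revCompile_mulVec_basisState]
  rfl

/-- The three Toffoli gates write the majority (`Literature.Computability.Complexity.maj3` of
`CircuitClassesProofs.lean`) onto a clear target: `ab ⊕ bc ⊕ ac = maj3 a b c`. [folklore] -/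
theorem xor_and_eq_maj3 (a b c : Bool) : (((false ^^ (a && b)) ^^ (b && c)) ^^ (a && c)) = maj3 a b c := by
  cases a <;> cases b <;> cases c <;> rfl

/-- **The semantics of stage 2 on wire `0`.** If the majority wire is clear, wire `0` receives the
majority of the three answer wires (wire `0` of the blocks). [cite: BennettBernsteinBrassardVazirani1997, Thm. 4.13 (proof; step 4)] -/
theorem clEval_prog2_zero (n : ℕ) (w : ℕ → Bool) (hw : w (mW P n) = false) :
    clEval (prog2 P n) w 0 = maj3 (w (blockW P n 0 0)) (w (blockW P n 1 0)) (w (blockW P n 2 0)) := by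
  have h1 := one_le_Pw P n
  have ha : blockW P n 0 0 ≠ mW P n := by unfold blockW mW; omega
  have hb : blockW P n 1 0 ≠ mW P n := by unfold blockW mW; omega
  have hc : blockW P n 2 0 ≠ mW P n := by unfold blockW mW; omega
  rw [prog2, clEval_append]
  -- after the majority gadget
  set w' := clEval (progMaj P n) w with hw'
  have hmaj : w' (mW P n) = maj3 (w (blockW P n 0 0)) (w (blockW P n 1 0)) (w (blockW P n 2 0)) := by
    rw [hw', progMaj]
    simp only [clEval_cons, clEval_nil, ClOp.eval_toffoli, update_self, update_of_ne ha, update_of_ne hb,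
      update_of_ne hc, hw]
    exact xor_and_eq_maj3 _ _ _
  rw [progOut, clEval_swap (mW P n) 0 (mW_ne_zero P n) w', ← hmaj]
  simp

/-- Stage 2 changes no wire other than `0` and the majority wire. [folklore] -/
theorem clEval_prog2_of_ne (n : ℕ) (w : ℕ → Bool) {i : ℕ} (hi0 : i ≠ 0) (him : i ≠ mW P n) :
    clEval (prog2 P n) w i = w i := by
  refine clEval_apply_of_forall_target_ne _ _ fun op hop => ?_
  simp only [prog2, progMaj, progOut, List.mem_append, List.mem_cons, List.not_mem_nil, or_false] at hop
  rcases hop with (rfl | rfl | rfl) | (rfl | rfl | rfl) <;> simp only [ClOp.target] <;> first | exact him.symm | exact hi0.symm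

end Maj3Amp

end Literature.Computability.QuantumComplexity

end
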